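import Summits.NavierStokesRegularity.NavierStokesRegularity.Theses.HardyPointSink
import Literature.Analysis.FluidPDE.AncientWeakL3BackwardLiouvilleHolds
import Summits.NavierStokesRegularity.NavierStokesRegularity.Theorems.HardyPointSinkNoHardyTypeIAncientHeart

/-!
# Route HardyPointSink — crux `NoHardyTypeIAncient` (stmt-NavierStokesRegularity-7980), line `birth`:
# the fact-stub is discharged — the line is the crux up to its envelope, unconditionally

Summit-side proof file (lead c4). The registered skeleton `Cruxes/NoHardyTypeIAncient/Lines/birth.lean`
composes `NoHardyTypeIAncient_of : Sig.stub_albrittonBarker2019Thm41 → Sig.stub_hardyEnvelope →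
NoHardyTypeIAncient`. Its FACT-stub — Albritton–Barker 2019, Thm 4.1 (`ε = 0`, Oseen class), the
Literature named fact `Literature.Analysis.FluidPDE.AlbrittonBarker2019_liouville_weakL3_backward` —
is now a tree THEOREM (`AlbrittonBarker2019_liouville_weakL3_backward_holds`,
`AncientWeakL3BackwardLiouvilleHolds.lean`, 2026-08-17). This file records the consequences:

* `stub_albrittonBarker2019Thm41` — the registered fact-stub, closed by the discharge;
* `hardyPointSink_hardyWeakL3Liouville` — the line's Liouville half in weak-`L³`, now
  UNCONDITIONAL (the landed `stub_hardyWeakL3LiouvilleOfAB41` fed with the discharge);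
* `hardyPointSink_noHardyTypeIAncient_of_hardyEnvelope` — the line's composition with the
  fact discharged: the envelope statement ALONE implies the crux;
* `hardyPointSink_noHardyTypeIAncient_iff_hardyEnvelope'` — hence the crux is EQUIVALENT to the
  envelope statement with no hypothesis left (c3's `…_iff_hardyEnvelope` fed with the discharge).

## References

* D. Albritton, T. Barker, J. Math. Fluid Mech. 21 (2019) no. 43 = arXiv:1811.00502, Thm 4.1, §4.
* T. Barker, G. Seregin, V. Šverák, arXiv:1603.03211, Def. 1.1, Lemma 3.4.
-/

noncomputable section

set_option linter.dupNamespace false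

open MeasureTheory Set Function Filter TopologicalSpace
open scoped ENNReal NNReal Topology

namespace Summit.NavierStokesRegularity.NavierStokesRegularity.Theorems

open Summit.NavierStokesRegularity.NavierStokesRegularity.Theses.HardyPointSink

/-- **The fact-stub of line `birth`, closed**: Albritton–Barker 2019, Thm 4.1 (`ε = 0`, final
time `t₀ < 0`, bounded Oseen integral-equation class) is the tree theorem
`AlbrittonBarker2019_liouville_weakL3_backward_holds`.
[cite: AlbrittonBarker2019, Thm 4.1 (arXiv:1811.00502 §4 p. 9)] -/
theorem stub_albrittonBarker2019Thm41 :
    Literature.Analysis.FluidPDE.AlbrittonBarker2019_liouville_weakL3_backward :=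
  Literature.Analysis.FluidPDE.AlbrittonBarker2019_liouville_weakL3_backward_holds

/-- **The Liouville half of line `birth` in weak-`L³`, UNCONDITIONAL.** A bounded ancient mild
solution of Navier–Stokes (`ν = 1`, duality form) with measurable slices, jointly a.e.-strongly
measurable on `(−∞, 0) × ℝ³`, Hardy-bounded about every centre at a.e. time, and bounded in
weak-`L³` along negative times `τ_k → −∞`, vanishes a.e. on a.e. slice (the landed
`stub_hardyWeakL3LiouvilleOfAB41` with the fact discharged).
[cite: AlbrittonBarker2019, Thm 4.1 (arXiv:1811.00502 §4 p. 9)] -/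
theorem hardyPointSink_hardyWeakL3Liouville :
    ∀ (u : ℝ → EuclideanSpace ℝ (Fin 3) → EuclideanSpace ℝ (Fin 3)),
      (∀ t < 0, AEStronglyMeasurable (u t) volume) →
      AEStronglyMeasurable (uncurry u)
        (volume.restrict (Iio (0 : ℝ) ×ˢ (univ : Set (EuclideanSpace ℝ (Fin 3))))) →
      Literature.Analysis.FluidPDE.IsBoundedAncientMildSolution 1 u →
      (∃ K : ℝ≥0, ∀ x₀ : EuclideanSpace ℝ (Fin 3), ∀ᵐ t ∂(volume.restrict (Iio (0 : ℝ))),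
        ∫⁻ x, ‖u t x‖ₑ ^ 2 / ‖x - x₀‖ₑ ≤ K) →
      (∃ (τ : ℕ → ℝ) (M : ℝ≥0∞), M < ⊤ ∧ Tendsto τ atTop atBot ∧ (∀ k, τ k < 0) ∧
        ∀ (k : ℕ) (s : ℝ), 0 < s →
          ENNReal.ofReal s ^ 3 * volume {x : EuclideanSpace ℝ (Fin 3) | s < ‖u (τ k) x‖} ≤ M) →
      ∀ᵐ t ∂(volume.restrict (Iio (0 : ℝ))), u t =ᵐ[volume] 0 :=
  stub_hardyWeakL3LiouvilleOfAB41 stub_albrittonBarker2019Thm41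

/-- **Line `birth` with its fact discharged: the envelope statement alone implies the crux.**
If every triple of the crux class (measurable slices, bounded ancient mild solution `ν = 1`,
suitable weak on the slab, weak spatial gradient, `𝐈(ℝ³ × ℝ₋) < ∞`, Hardy bound about every centre
at a.e. time) admits negative times `τ_k → −∞` with a uniform weak-`L³` bound, then
`HardyPointSink.NoHardyTypeIAncient` holds (the `←` direction of
`hardyPointSink_noHardyTypeIAncient_iff_hardyEnvelope`, fed with the discharge of A–B Thm 4.1).
[cite: AlbrittonBarker2019, Thm 4.1 (arXiv:1811.00502 §4 p. 9)] -/
theorem hardyPointSink_noHardyTypeIAncient_of_hardyEnvelope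
    (hEnv : ∀ (u : ℝ → EuclideanSpace ℝ (Fin 3) → EuclideanSpace ℝ (Fin 3))
      (p : ℝ → EuclideanSpace ℝ (Fin 3) → ℝ)
      (G : ℝ → EuclideanSpace ℝ (Fin 3) → EuclideanSpace ℝ (Fin 3) →L[ℝ] EuclideanSpace ℝ (Fin 3)),
      (∀ t < 0, AEStronglyMeasurable (u t) volume) →
      Literature.Analysis.FluidPDE.IsBoundedAncientMildSolution 1 u →
      Literature.Analysis.FluidPDE.IsSuitableWeakSolutionOn
        (Literature.Analysis.FluidPDE.slab (EuclideanSpace ℝ (Fin 3)) (Iio 0) isOpen_Iio) 1 0 u p →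
      Literature.Analysis.FluidPDE.HasWeakSpatialGradientOn
        (Literature.Analysis.FluidPDE.slab (EuclideanSpace ℝ (Fin 3)) (Iio 0) isOpen_Iio) u G →
      Literature.Analysis.FluidPDE.typeIBound
        (Iio (0 : ℝ) ×ˢ (univ : Set (EuclideanSpace ℝ (Fin 3)))) u p G < ⊤ →
      (∃ K : ℝ≥0, ∀ x₀ : EuclideanSpace ℝ (Fin 3), ∀ᵐ t ∂(volume.restrict (Iio (0 : ℝ))),
        ∫⁻ x, ‖u t x‖ₑ ^ 2 / ‖x - x₀‖ₑ ≤ K) →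
      ∃ (τ : ℕ → ℝ) (M : ℝ≥0∞), M < ⊤ ∧ Tendsto τ atTop atBot ∧ (∀ k, τ k < 0) ∧
        ∀ (k : ℕ) (s : ℝ), 0 < s →
          ENNReal.ofReal s ^ 3 * volume {x : EuclideanSpace ℝ (Fin 3) | s < ‖u (τ k) x‖} ≤ M) :
    NoHardyTypeIAncient :=
  (hardyPointSink_noHardyTypeIAncient_iff_hardyEnvelope stub_albrittonBarker2019Thm41).2 hEnv

/-- **Heart ≡ crux, unconditionally.** The crux `HardyPointSink.NoHardyTypeIAncient` is
EQUIVALENT to the statement of the only open stub `stub_hardyEnvelope` of line `birth` (uniform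
weak-`L³` bound along a backward sequence of times for every triple of the crux class) — c3's
`hardyPointSink_noHardyTypeIAncient_iff_hardyEnvelope` with its hypothesis (A–B Thm 4.1) now
discharged. [cite: AlbrittonBarker2019, Thm 4.1 (arXiv:1811.00502 §4 p. 9)] -/
theorem hardyPointSink_noHardyTypeIAncient_iff_hardyEnvelope' :
    Summit.NavierStokesRegularity.NavierStokesRegularity.Theses.HardyPointSink.NoHardyTypeIAncient ↔
    ∀ (u : ℝ → EuclideanSpace ℝ (Fin 3) → EuclideanSpace ℝ (Fin 3))
      (p : ℝ → EuclideanSpace ℝ (Fin 3) → ℝ)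
      (G : ℝ → EuclideanSpace ℝ (Fin 3) → EuclideanSpace ℝ (Fin 3) →L[ℝ] EuclideanSpace ℝ (Fin 3)),
      (∀ t < 0, AEStronglyMeasurable (u t) volume) →
      Literature.Analysis.FluidPDE.IsBoundedAncientMildSolution 1 u →
      Literature.Analysis.FluidPDE.IsSuitableWeakSolutionOn
        (Literature.Analysis.FluidPDE.slab (EuclideanSpace ℝ (Fin 3)) (Iio 0) isOpen_Iio) 1 0 u p →
      Literature.Analysis.FluidPDE.HasWeakSpatialGradientOn
        (Literature.Analysis.FluidPDE.slab (EuclideanSpace ℝ (Fin 3)) (Iio 0) isOpen_Iio) u G →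
      Literature.Analysis.FluidPDE.typeIBound
        (Iio (0 : ℝ) ×ˢ (univ : Set (EuclideanSpace ℝ (Fin 3)))) u p G < ⊤ →
      (∃ K : ℝ≥0, ∀ x₀ : EuclideanSpace ℝ (Fin 3), ∀ᵐ t ∂(volume.restrict (Iio (0 : ℝ))),
        ∫⁻ x, ‖u t x‖ₑ ^ 2 / ‖x - x₀‖ₑ ≤ K) →
      ∃ (τ : ℕ → ℝ) (M : ℝ≥0∞), M < ⊤ ∧ Tendsto τ atTop atBot ∧ (∀ k, τ k < 0) ∧
        ∀ (k : ℕ) (s : ℝ), 0 < s →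
          ENNReal.ofReal s ^ 3 * volume {x : EuclideanSpace ℝ (Fin 3) | s < ‖u (τ k) x‖} ≤ M :=
  hardyPointSink_noHardyTypeIAncient_iff_hardyEnvelope stub_albrittonBarker2019Thm41

end Summit.NavierStokesRegularity.NavierStokesRegularity.Theorems

end
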